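import Literature.MathematicalPhysics.QuantumLattice.HubbardNNNHopping
import HarnessLib

/-!
# Cutting the `t–t'` Hubbard torus: almost-subadditivity of the sector ground-state energies
# (towards the thermodynamic limit of the published `t–t'` model, Ruelle §3.3)

Family `hubbard` (topic `MathematicalPhysics/QuantumLattice`). Continuation of
`HubbardRectangularTorus.lean` (the major cut `groundEnergyAt_rect_cut` of the nearest-neighbour
model) and `HubbardNNNHopping.lean` (the published `t–t'` Hamiltonian
`hubbardRectTorusTT' a b t t' U = hamiltonian (n.n. graph) t U + hamiltonian (diagonal graph) t' 0`,
LeBlanc et al. PRX 5 (2015) 041041 eq. (1); Xu et al. Science 384 (2024) eq. (1)) to the first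
step of the existence proof of the thermodynamic-limit ground-state energy density of the `t–t'`
model (Ruelle, *Statistical Mechanics* (1969), §2.2, §3.3: subadditivity by cutting boxes):

* `ThermodynamicLimit.re_dotProduct_hamiltonian_blockProd_le` — the product-trial-state estimate
  behind `groundEnergyAt_le_add_of_cut`, exported for ONE graph Hamiltonian `hamiltonian G t U`
  and the graded tensor product `ψ₁ ⊗ ψ₂` of block vectors: hopping across the cut has zero
  expectation, block terms reproduce `⟨ψ_i, · ψ_i⟩`, each of the `≤ k₁ + k₂` discrepant ordered
  bonds costs `≤ 2|t|`;
* `ThermodynamicLimit.groundEnergy_twoGraph_le_add_of_cut` — the cut lemma for a TWO-GRAPH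
  Hamiltonian `hamiltonian G t U + hamiltonian G' t' U'` (same sites, two bond sets, two
  amplitudes): `E(N₁ + N₂) ≤ E₁(N₁) + E₂(N₂) + 2|t|(k₁ + k₂) + 2|t'|(k₁' + k₂')`;
* the DIAGONAL seam: inside a block of the cut of `ℤ/(a₁+a₂)ℤ × ℤ/bℤ` at `a₁` the diagonal
  adjacency of the big torus and that of the block torus differ on at most `4b` ordered pairs
  (`card_discrepancy_diag_rectCastAdd`, `card_discrepancy_diag_rectNatAdd`; the n.n. seam has
  `≤ 2b`, `card_discrepancy_rectCastAdd`);
* **the major cut of the `t–t'` torus** `groundEnergy_hubbardRectTorusTT'_cut`: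
  `E_{(a₁+a₂)×b}(N₁ + N₂) ≤ E_{a₁×b}(N₁) + E_{a₂×b}(N₂) + 8|t| b + 16|t'| b` (`N_i ≤ 2 a_i b`);
* swap invariance `groundEnergy_hubbardRectTorusTT'_swap`: `E_{a×b}(N) = E_{b×a}(N)` (the
  coordinate swap is an isomorphism of both graphs; `groundEnergy_relabel`).

Everything is proved; no definition is introduced. These are the inputs of the tiling / Fekete
argument for `lim_L E_{L×L}(N_L(n))/L²` of the `t–t'` model (to follow the n.n. chain
`HubbardTorus2DTiling.lean` → `HubbardTorus2DEnergyDensity.lean`).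

## References

* D. Ruelle, *Statistical Mechanics: Rigorous Results* (Benjamin, 1969), §2.2, §3.3
  (thermodynamic limit of lattice systems by subadditivity over boxes). [cite: Ruelle1969, §3.3]
* J. P. F. LeBlanc et al., Phys. Rev. X 5 (2015) 041041, eq. (1) (the `t–t'` Hubbard model whose
  thermodynamic-limit energies are benchmarked). [cite: LeBlancEtAl2015, eq. (1)]
-/

noncomputable section

open Matrix Finset
open scoped ComplexOrder BigOperators

namespace Literature.MathematicalPhysics.QuantumLattice

namespace ThermodynamicLimit

/-! ### The product-trial-state estimate, exported, and the two-graph cut lemma -/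

section TwoGraphCut

variable {Λ₁ Λ₂ Λ : Type*} [LinearOrder Λ₁] [Fintype Λ₁] [LinearOrder Λ₂] [Fintype Λ₂]
  [LinearOrder Λ] [Fintype Λ]

/-- **Product-trial-state estimate for one graph Hamiltonian.** Let the sites of `G` be the
ordered disjoint union of those of `G₁` (below, along `e₁`) and `G₂` (above, along `e₂`), the
adjacency of `G` on block `i` differing from that of `G_i` on at most `k_i` ordered pairs. For unit
block vectors `ψ₁` (of definite particle number) and `ψ₂`, the graded tensor product
`Ψ = ψ₁ ⊗ ψ₂` satisfies `Re⟨Ψ, H_G Ψ⟩ ≤ Re⟨ψ₁, H_{G₁} ψ₁⟩ + Re⟨ψ₂, H_{G₂} ψ₂⟩ + 2|t|(k₁ + k₂)`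
(`H_G = hamiltonian G t U`): hopping across the cut has zero expectation, block terms factorise,
each discrepant bond costs `≤ 2|t|`. This is the estimate inside `groundEnergyAt_le_add_of_cut`,
stated for the trial state itself so that it can be ADDED over several bond sets.
Ruelle (1969) §2.2. [cite: Ruelle1969, §3.3] -/
theorem re_dotProduct_hamiltonian_blockProd_le (G₁ : SimpleGraph Λ₁) (G₂ : SimpleGraph Λ₂)
    (G : SimpleGraph Λ) [DecidableRel G₁.Adj] [DecidableRel G₂.Adj] [DecidableRel G.Adj]
    {e₁ : Λ₁ → Λ} {e₂ : Λ₂ → Λ} (he₁ : StrictMono e₁) (he₂ : StrictMono e₂)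
    (h12 : ∀ x y, e₁ x < e₂ y) (hcov : ∀ z, (∃ x, e₁ x = z) ∨ ∃ y, e₂ y = z)
    {k₁ k₂ : ℕ} (hk₁ : #{p : Λ₁ × Λ₁ | ¬ (G.Adj (e₁ p.1) (e₁ p.2) ↔ G₁.Adj p.1 p.2)} ≤ k₁)
    (hk₂ : #{p : Λ₂ × Λ₂ | ¬ (G.Adj (e₂ p.1) (e₂ p.2) ↔ G₂.Adj p.1 p.2)} ≤ k₂) (t U : ℝ)
    {N₁ : ℕ} {ψ₁ : Fock (Orb Λ₁)} {ψ₂ : Fock (Orb Λ₂)} (hψ₁N : IsNParticle N₁ ψ₁)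
    (hψ₁ : star ψ₁ ⬝ᵥ ψ₁ = 1) (hψ₂ : star ψ₂ ⬝ᵥ ψ₂ = 1) :
    (star (fun s : Finset (Orb Λ) => ψ₁ {p | orb (e₁ (ofLex p).1) (ofLex p).2 ∈ s} *
          ψ₂ {q | orb (e₂ (ofLex q).1) (ofLex q).2 ∈ s}) ⬝ᵥ
        (hamiltonian G t U *ᵥ fun s : Finset (Orb Λ) =>
          ψ₁ {p | orb (e₁ (ofLex p).1) (ofLex p).2 ∈ s} *
            ψ₂ {q | orb (e₂ (ofLex q).1) (ofLex q).2 ∈ s})).re ≤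
      (star ψ₁ ⬝ᵥ (hamiltonian G₁ t U *ᵥ ψ₁)).re + (star ψ₂ ⬝ᵥ (hamiltonian G₂ t U *ᵥ ψ₂)).re +
        2 * |t| * (k₁ + k₂) := by
  -- orbital maps
  set O₁ : Orb Λ₁ → Orb Λ := fun p => orb (e₁ (ofLex p).1) (ofLex p).2 with hO₁
  set O₂ : Orb Λ₂ → Orb Λ := fun q => orb (e₂ (ofLex q).1) (ofLex q).2 with hO₂
  have hO₁m : StrictMono O₁ := strictMono_orbMap he₁
  have hO₂m : StrictMono O₂ := strictMono_orbMap he₂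
  have hO12 : ∀ p q, O₁ p < O₂ q := orbMap_lt_orbMap h12
  have hOcov : ∀ r, (∃ p, O₁ p = r) ∨ ∃ q, O₂ q = r := orbMap_cover hcov
  have he₁i : Function.Injective e₁ := he₁.injective
  have he₂i : Function.Injective e₂ := he₂.injective
  have hene : ∀ x y, e₁ x ≠ e₂ y := fun x y => (h12 x y).ne
  set Ψ : Fock (Orb Λ) := fun s => ψ₁ {p | O₁ p ∈ s} * ψ₂ {q | O₂ q ∈ s} with hΨ
  -- block amplitudes
  set F₁ : Λ₁ → Λ₁ → Fin 2 → ℂ := fun x x' σ =>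
    star (annihilation (orb x σ) *ᵥ ψ₁) ⬝ᵥ (annihilation (orb x' σ) *ᵥ ψ₁) with hF₁
  set F₂ : Λ₂ → Λ₂ → Fin 2 → ℂ := fun y y' σ =>
    star (annihilation (orb y σ) *ᵥ ψ₂) ⬝ᵥ (annihilation (orb y' σ) *ᵥ ψ₂) with hF₂
  set D₁ : Λ₁ → ℂ := fun x => star ψ₁ ⬝ᵥ (numberOp x 0 *ᵥ (numberOp x 1 *ᵥ ψ₁)) with hD₁
  set D₂ : Λ₂ → ℂ := fun y => star ψ₂ ⬝ᵥ (numberOp y 0 *ᵥ (numberOp y 1 *ᵥ ψ₂)) with hD₂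
  have hF11 : ∀ x x' σ, star (annihilation (orb (e₁ x) σ) *ᵥ Ψ) ⬝ᵥ
      (annihilation (orb (e₁ x') σ) *ᵥ Ψ) = F₁ x x' σ := by
    intro x x' σ
    have h := dotProduct_annihilation_low_low hO₁m hO₂m hO12 hOcov ψ₁ ψ₂ (orb x σ) (orb x' σ)
    rw [hψ₂, mul_one] at h
    exact h
  have hF22 : ∀ y y' σ, star (annihilation (orb (e₂ y) σ) *ᵥ Ψ) ⬝ᵥ
      (annihilation (orb (e₂ y') σ) *ᵥ Ψ) = F₂ y y' σ := by
    intro y y' σ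
    have h := dotProduct_annihilation_high_high hO₁m hO₂m hO12 hOcov ψ₁ ψ₂ (orb y σ) (orb y' σ)
    rw [hψ₁, one_mul] at h
    exact h
  have hF12 : ∀ x y σ, star (annihilation (orb (e₁ x) σ) *ᵥ Ψ) ⬝ᵥ
      (annihilation (orb (e₂ y) σ) *ᵥ Ψ) = 0 := fun x y σ =>
    dotProduct_annihilation_low_high hO₁m hO₂m hO12 hOcov hψ₁N ψ₂ (orb x σ) (orb y σ)
  have hF21 : ∀ y x σ, star (annihilation (orb (e₂ y) σ) *ᵥ Ψ) ⬝ᵥ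
      (annihilation (orb (e₁ x) σ) *ᵥ Ψ) = 0 := fun y x σ =>
    dotProduct_annihilation_high_low hO₁m hO₂m hO12 hOcov hψ₁N ψ₂ (orb x σ) (orb y σ)
  have hD1 : ∀ x, star Ψ ⬝ᵥ (numberOp (e₁ x) 0 *ᵥ (numberOp (e₁ x) 1 *ᵥ Ψ)) = D₁ x := by
    intro x
    have h := dotProduct_numberAt_numberAt_low hO₁m hO₂m hO12 hOcov ψ₁ ψ₂ (orb x 0) (orb x 1)
    rw [hψ₂, mul_one] at h
    exact h
  have hD2 : ∀ y, star Ψ ⬝ᵥ (numberOp (e₂ y) 0 *ᵥ (numberOp (e₂ y) 1 *ᵥ Ψ)) = D₂ y := by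
    intro y
    have h := dotProduct_numberAt_numberAt_high hO₁m hO₂m hO12 hOcov ψ₁ ψ₂ (orb y 0) (orb y 1)
    rw [hψ₁, one_mul] at h
    exact h
  -- the hopping sums
  set A₁' : ℂ := ∑ x, ∑ x', if G.Adj (e₁ x) (e₁ x') then ∑ σ, F₁ x x' σ else 0 with hA₁'
  set A₂' : ℂ := ∑ y, ∑ y', if G.Adj (e₂ y) (e₂ y') then ∑ σ, F₂ y y' σ else 0 with hA₂'
  set A₁ : ℂ := ∑ x, ∑ x', if G₁.Adj x x' then ∑ σ, F₁ x x' σ else 0 with hA₁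
  set A₂ : ℂ := ∑ y, ∑ y', if G₂.Adj y y' then ∑ σ, F₂ y y' σ else 0 with hA₂
  have hbig : star Ψ ⬝ᵥ (hamiltonian G t U *ᵥ Ψ) =
      -(t : ℂ) * (A₁' + A₂') + (U : ℂ) * (∑ x, D₁ x + ∑ y, D₂ y) := by
    rw [dotProduct_hamiltonian_mulVec]
    congr 2
    · rw [sum_eq_sum_add_sum_of_cut he₁i he₂i hene hcov]
      congr 1
      · refine Finset.sum_congr rfl fun x _ => ?_
        rw [sum_eq_sum_add_sum_of_cut he₁i he₂i hene hcov]
        simp only [hF11, hF12, ite_self, Finset.sum_const_zero, add_zero, sum_ite_const_cond]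
      · refine Finset.sum_congr rfl fun y _ => ?_
        rw [sum_eq_sum_add_sum_of_cut he₁i he₂i hene hcov]
        simp only [hF22, hF21, ite_self, Finset.sum_const_zero, zero_add, sum_ite_const_cond]
    · rw [sum_eq_sum_add_sum_of_cut he₁i he₂i hene hcov]
      simp only [hD1, hD2]
  have hone : star ψ₁ ⬝ᵥ (hamiltonian G₁ t U *ᵥ ψ₁) = -(t : ℂ) * A₁ + (U : ℂ) * ∑ x, D₁ x := by
    rw [dotProduct_hamiltonian_mulVec]
    simp only [sum_ite_const_cond, hA₁, hF₁, hD₁]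
  have htwo : star ψ₂ ⬝ᵥ (hamiltonian G₂ t U *ᵥ ψ₂) = -(t : ℂ) * A₂ + (U : ℂ) * ∑ y, D₂ y := by
    rw [dotProduct_hamiltonian_mulVec]
    simp only [sum_ite_const_cond, hA₂, hF₂, hD₂]
  -- the few differing bonds
  have hbF₁ : ∀ x x', ‖∑ σ, F₁ x x' σ‖ ≤ 2 := by
    intro x x'
    calc ‖∑ σ, F₁ x x' σ‖ ≤ ∑ σ, ‖F₁ x x' σ‖ := norm_sum_le _ _
      _ ≤ ∑ _σ : Fin 2, (1 : ℝ) := Finset.sum_le_sum fun σ _ =>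
          norm_dotProduct_annihilation_le_one hψ₁ _ _
      _ = 2 := by simp
  have hbF₂ : ∀ y y', ‖∑ σ, F₂ y y' σ‖ ≤ 2 := by
    intro y y'
    calc ‖∑ σ, F₂ y y' σ‖ ≤ ∑ σ, ‖F₂ y y' σ‖ := norm_sum_le _ _
      _ ≤ ∑ _σ : Fin 2, (1 : ℝ) := Finset.sum_le_sum fun σ _ =>
          norm_dotProduct_annihilation_le_one hψ₂ _ _
      _ = 2 := by simp
  have hΔ₁ : ‖A₁' - A₁‖ ≤ k₁ * 2 :=
    norm_sum_ite_sub_sum_ite_le (fun x x' => G.Adj (e₁ x) (e₁ x')) G₁.Adj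
      (fun x x' => ∑ σ, F₁ x x' σ) zero_le_two hbF₁ hk₁
  have hΔ₂ : ‖A₂' - A₂‖ ≤ k₂ * 2 :=
    norm_sum_ite_sub_sum_ite_le (fun y y' => G.Adj (e₂ y) (e₂ y')) G₂.Adj
      (fun y y' => ∑ σ, F₂ y y' σ) zero_le_two hbF₂ hk₂
  have key : ∀ w : ℂ, (-(t : ℂ) * w).re ≤ |t| * ‖w‖ := fun w =>
    (Complex.re_le_norm _).trans (by rw [norm_mul, norm_neg, Complex.norm_real, Real.norm_eq_abs])
  have hsplit : -(t : ℂ) * (A₁' + A₂') + (U : ℂ) * (∑ x, D₁ x + ∑ y, D₂ y) =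
      (-(t : ℂ) * A₁ + (U : ℂ) * ∑ x, D₁ x) + (-(t : ℂ) * A₂ + (U : ℂ) * ∑ y, D₂ y) +
        (-(t : ℂ) * (A₁' - A₁)) + (-(t : ℂ) * (A₂' - A₂)) := by ring
  rw [hbig, hsplit, Complex.add_re, Complex.add_re, Complex.add_re, hone, htwo]
  have h1 := key (A₁' - A₁)
  have h2 := key (A₂' - A₂)
  have h3 : |t| * ‖A₁' - A₁‖ ≤ |t| * (k₁ * 2) := mul_le_mul_of_nonneg_left hΔ₁ (abs_nonneg t)
  have h4 : |t| * ‖A₂' - A₂‖ ≤ |t| * (k₂ * 2) := mul_le_mul_of_nonneg_left hΔ₂ (abs_nonneg t)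
  linarith

/-- **Almost-subadditivity under a cut for a two-graph Hamiltonian.** With the sites of `Λ` the
ordered disjoint union of `Λ₁` (below) and `Λ₂` (above) as in `groundEnergyAt_le_add_of_cut`, two
bond sets `G, G'` on `Λ` with block graphs `G_i, G_i'`, discrepancies `≤ k_i` (for `G`) and
`≤ k_i'` (for `G'`), amplitudes `t, t'` and couplings `U, U'`: for all sectors `N_i ≤ 2|Λ_i|`,
`E(N₁ + N₂) ≤ E₁(N₁) + E₂(N₂) + 2|t|(k₁ + k₂) + 2|t'|(k₁' + k₂')`, where `E`, `E_i` are the sector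
ground-state energies (`groundEnergy`) of `hamiltonian G t U + hamiltonian G' t' U'` and of
`hamiltonian G_i t U + hamiltonian G_i' t' U'`. (The product trial state of two approximate
minimisers; the estimate `re_dotProduct_hamiltonian_blockProd_le` for each bond set.) The case
`G' = diagonal bonds, U' = 0` is the `t–t'` Hubbard model. Ruelle (1969) §2.2.
[cite: Ruelle1969, §3.3] -/
theorem groundEnergy_twoGraph_le_add_of_cut (G₁ G₁' : SimpleGraph Λ₁) (G₂ G₂' : SimpleGraph Λ₂)
    (G G' : SimpleGraph Λ) [DecidableRel G₁.Adj] [DecidableRel G₁'.Adj] [DecidableRel G₂.Adj]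
    [DecidableRel G₂'.Adj] [DecidableRel G.Adj] [DecidableRel G'.Adj]
    {e₁ : Λ₁ → Λ} {e₂ : Λ₂ → Λ} (he₁ : StrictMono e₁) (he₂ : StrictMono e₂)
    (h12 : ∀ x y, e₁ x < e₂ y) (hcov : ∀ z, (∃ x, e₁ x = z) ∨ ∃ y, e₂ y = z)
    {k₁ k₂ k₁' k₂' : ℕ} (hk₁ : #{p : Λ₁ × Λ₁ | ¬ (G.Adj (e₁ p.1) (e₁ p.2) ↔ G₁.Adj p.1 p.2)} ≤ k₁)
    (hk₂ : #{p : Λ₂ × Λ₂ | ¬ (G.Adj (e₂ p.1) (e₂ p.2) ↔ G₂.Adj p.1 p.2)} ≤ k₂)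
    (hk₁' : #{p : Λ₁ × Λ₁ | ¬ (G'.Adj (e₁ p.1) (e₁ p.2) ↔ G₁'.Adj p.1 p.2)} ≤ k₁')
    (hk₂' : #{p : Λ₂ × Λ₂ | ¬ (G'.Adj (e₂ p.1) (e₂ p.2) ↔ G₂'.Adj p.1 p.2)} ≤ k₂')
    (t U t' U' : ℝ) {N₁ N₂ : ℕ} (hN₁ : N₁ ≤ 2 * Fintype.card Λ₁)
    (hN₂ : N₂ ≤ 2 * Fintype.card Λ₂) :
    groundEnergy (hamiltonian G t U + hamiltonian G' t' U') (N₁ + N₂) ≤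
      groundEnergy (hamiltonian G₁ t U + hamiltonian G₁' t' U') N₁ +
        groundEnergy (hamiltonian G₂ t U + hamiltonian G₂' t' U') N₂ +
        2 * |t| * (k₁ + k₂) + 2 * |t'| * (k₁' + k₂') := by
  have hO₁m : StrictMono (fun p : Orb Λ₁ => orb (e₁ (ofLex p).1) (ofLex p).2) :=
    strictMono_orbMap he₁
  have hO₂m : StrictMono (fun q : Orb Λ₂ => orb (e₂ (ofLex q).1) (ofLex q).2) :=
    strictMono_orbMap he₂
  have hO12 : ∀ (p : Orb Λ₁) (q : Orb Λ₂),
      orb (e₁ (ofLex p).1) (ofLex p).2 < orb (e₂ (ofLex q).1) (ofLex q).2 := orbMap_lt_orbMap h12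
  have hOcov := orbMap_cover (e₁ := e₁) (e₂ := e₂) hcov
  have hOne : ∀ (p : Orb Λ₁) (q : Orb Λ₂),
      orb (e₁ (ofLex p).1) (ofLex p).2 ≠ orb (e₂ (ofLex q).1) (ofLex q).2 := fun p q => (hO12 p q).ne
  -- the estimate for product trial states
  have main : ∀ (ψ₁ : Fock (Orb Λ₁)) (ψ₂ : Fock (Orb Λ₂)), IsNParticle N₁ ψ₁ → IsNParticle N₂ ψ₂ →
      star ψ₁ ⬝ᵥ ψ₁ = 1 → star ψ₂ ⬝ᵥ ψ₂ = 1 →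
      groundEnergy (hamiltonian G t U + hamiltonian G' t' U') (N₁ + N₂) ≤
        (star ψ₁ ⬝ᵥ ((hamiltonian G₁ t U + hamiltonian G₁' t' U') *ᵥ ψ₁)).re +
          (star ψ₂ ⬝ᵥ ((hamiltonian G₂ t U + hamiltonian G₂' t' U') *ᵥ ψ₂)).re +
          2 * |t| * (k₁ + k₂) + 2 * |t'| * (k₁' + k₂') := by
    intro ψ₁ ψ₂ hψ₁N hψ₂N hψ₁ hψ₂
    set Ψ : Fock (Orb Λ) := fun s => ψ₁ {p | orb (e₁ (ofLex p).1) (ofLex p).2 ∈ s} *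
      ψ₂ {q | orb (e₂ (ofLex q).1) (ofLex q).2 ∈ s} with hΨ
    have hΨ1 : star Ψ ⬝ᵥ Ψ = 1 := by
      rw [hΨ, dotProduct_prodVec hO₁m.injective hO₂m.injective hOne hOcov, hψ₁, hψ₂, one_mul]
    have hΨN : IsNParticle (N₁ + N₂) Ψ := isNParticle_prodVec hO₁m hO₂m hO12 hOcov hψ₁N hψ₂N
    have hE : groundEnergy (hamiltonian G t U + hamiltonian G' t' U') (N₁ + N₂) ≤
        (star Ψ ⬝ᵥ ((hamiltonian G t U + hamiltonian G' t' U') *ᵥ Ψ)).re :=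
      groundEnergy_le_re_expect _ hΨN hΨ1
    have h1 : (star Ψ ⬝ᵥ (hamiltonian G t U *ᵥ Ψ)).re ≤
        (star ψ₁ ⬝ᵥ (hamiltonian G₁ t U *ᵥ ψ₁)).re + (star ψ₂ ⬝ᵥ (hamiltonian G₂ t U *ᵥ ψ₂)).re +
          2 * |t| * (k₁ + k₂) :=
      re_dotProduct_hamiltonian_blockProd_le G₁ G₂ G he₁ he₂ h12 hcov hk₁ hk₂ t U hψ₁N hψ₁ hψ₂
    have h2 : (star Ψ ⬝ᵥ (hamiltonian G' t' U' *ᵥ Ψ)).re ≤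
        (star ψ₁ ⬝ᵥ (hamiltonian G₁' t' U' *ᵥ ψ₁)).re +
          (star ψ₂ ⬝ᵥ (hamiltonian G₂' t' U' *ᵥ ψ₂)).re + 2 * |t'| * (k₁' + k₂') :=
      re_dotProduct_hamiltonian_blockProd_le G₁' G₂' G' he₁ he₂ h12 hcov hk₁' hk₂' t' U' hψ₁N
        hψ₁ hψ₂
    rw [add_mulVec, dotProduct_add, Complex.add_re] at hE
    rw [add_mulVec, dotProduct_add, Complex.add_re, add_mulVec, dotProduct_add, Complex.add_re]
    linarith
  -- pass to the infima
  have hc₁ : N₁ ≤ Fintype.card (Orb Λ₁) := by rw [card_orb]; exact hN₁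
  have hc₂ : N₂ ≤ Fintype.card (Orb Λ₂) := by rw [card_orb]; exact hN₂
  refine le_of_forall_pos_lt_add fun ε hε => ?_
  obtain ⟨ψ₁, hψ₁N, hψ₁, hlt₁⟩ := exists_re_expect_lt (hamiltonian G₁ t U + hamiltonian G₁' t' U')
    hc₁ (show groundEnergy (hamiltonian G₁ t U + hamiltonian G₁' t' U') N₁ <
      groundEnergy (hamiltonian G₁ t U + hamiltonian G₁' t' U') N₁ + ε / 2 by linarith)
  obtain ⟨ψ₂, hψ₂N, hψ₂, hlt₂⟩ := exists_re_expect_lt (hamiltonian G₂ t U + hamiltonian G₂' t' U')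
    hc₂ (show groundEnergy (hamiltonian G₂ t U + hamiltonian G₂' t' U') N₂ <
      groundEnergy (hamiltonian G₂ t U + hamiltonian G₂' t' U') N₂ + ε / 2 by linarith)
  have h := main ψ₁ ψ₂ hψ₁N hψ₂N hψ₁ hψ₂
  unfold QuantumLattice.expect at hlt₁ hlt₂
  linarith

end TwoGraphCut

end ThermodynamicLimit

/-! ### The diagonal seam of the cut of `ℤ/(a₁+a₂)ℤ × ℤ/bℤ` at `a₁` -/

section DiagSeam

open ThermodynamicLimit

/-- Ordered ring-neighbour pairs of `ℤ/bℤ` (representatives) number at most `2b`: every `u` has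
at most the two neighbours `u ± 1`. [folklore] -/
private theorem card_filter_ringAdj_le (b : ℕ) :
    #{uv : Fin b × Fin b | ringAdj b uv.1 uv.2} ≤ 2 * b := by
  calc #{uv : Fin b × Fin b | ringAdj b uv.1 uv.2}
      ≤ #((Finset.univ : Finset (Fin b)).biUnion fun u : Fin b =>
          ({((u : ℕ), ((u : ℕ) + 1) % b), ((u : ℕ), ((u : ℕ) + (b - 1)) % b)} : Finset (ℕ × ℕ))) := by
        refine Finset.card_le_card_of_injOn (fun uv => (((uv.1 : Fin b) : ℕ), ((uv.2 : Fin b) : ℕ)))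
          ?_ ?_
        · intro uv huv
          rw [Finset.mem_coe, Finset.mem_filter] at huv
          obtain ⟨-, -, h⟩ := huv
          rw [Finset.coe_biUnion, Set.mem_iUnion₂]
          refine ⟨uv.1, Finset.mem_coe.2 (Finset.mem_univ _), ?_⟩
          rw [Finset.mem_coe, Finset.mem_insert, Finset.mem_singleton]
          rcases h with h | h
          · exact Or.inl (Prod.ext rfl h.symm)
          · exact Or.inr (Prod.ext rfl (eq_mod_of_succ_mod_eq uv.1.isLt uv.2.isLt h))
        · intro uv _ uv' _ h
          simp only [Prod.mk.injEq] at h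
          exact Prod.ext (Fin.ext h.1) (Fin.ext h.2)
    _ ≤ ∑ _u : Fin b, 2 := by
        refine Finset.card_biUnion_le.trans (Finset.sum_le_sum fun u _ => Finset.card_le_two)
    _ = 2 * b := by
        rw [Finset.sum_const, Finset.card_univ, Fintype.card_fin, smul_eq_mul, mul_comm]

/-- Diagonal adjacency of the big torus on the lower block. [folklore] -/
private theorem diag_adj_rectCastAdd_iff {a₁ a₂ b : ℕ} (p q : Fin a₁ ×ₗ Fin b) :
    (fermionRectTorusDiagGraph (a₁ + a₂) b).Adj (rectCastAdd a₁ a₂ b p) (rectCastAdd a₁ a₂ b q) ↔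
      ringAdj (a₁ + a₂) (ofLex p).1 (ofLex q).1 ∧ ringAdj b (ofLex p).2 (ofLex q).2 := by
  rw [fermionRectTorusDiagGraph_adj_iff, rectCastAdd, rectCastAdd]
  simp only [ofLex_toLex, Fin.val_castAdd]

/-- Diagonal adjacency of the big torus on the upper block. [folklore] -/
private theorem diag_adj_rectNatAdd_iff {a₁ a₂ b : ℕ} (p q : Fin a₂ ×ₗ Fin b) :
    (fermionRectTorusDiagGraph (a₁ + a₂) b).Adj (rectNatAdd a₁ a₂ b p) (rectNatAdd a₁ a₂ b q) ↔
      ringAdj (a₁ + a₂) (a₁ + (ofLex p).1) (a₁ + (ofLex q).1) ∧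
        ringAdj b (ofLex p).2 (ofLex q).2 := by
  rw [fermionRectTorusDiagGraph_adj_iff, rectNatAdd, rectNatAdd]
  simp only [ofLex_toLex, Fin.val_natAdd]

/-- **The diagonal seam, lower block**: the diagonal adjacency of `ℤ/(a₁+a₂)ℤ × ℤ/bℤ` restricted to
the block `ℤ/a₁ℤ × ℤ/bℤ` differs from the block's own diagonal adjacency on at most `4b` ordered
pairs (the wrap-around pairs `{0, a₁ - 1}` in the first coordinate times the `≤ 2b` ordered
ring-neighbour pairs in the second); the counting step of Ruelle's box cut for the diagonal bonds.
[cite: Ruelle1969, §2.2] -/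
theorem card_discrepancy_diag_rectCastAdd (a₁ a₂ b : ℕ) :
    #{pq : (Fin a₁ ×ₗ Fin b) × (Fin a₁ ×ₗ Fin b) |
        ¬ ((fermionRectTorusDiagGraph (a₁ + a₂) b).Adj (rectCastAdd a₁ a₂ b pq.1)
            (rectCastAdd a₁ a₂ b pq.2) ↔ (fermionRectTorusDiagGraph a₁ b).Adj pq.1 pq.2)} ≤
      4 * b := by
  calc _ ≤ #(({((0 : ℕ), a₁ - 1), (a₁ - 1, 0)} : Finset (ℕ × ℕ)) ×ˢ
          ({uv : Fin b × Fin b | ringAdj b uv.1 uv.2} : Finset (Fin b × Fin b))) := by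
        refine Finset.card_le_card_of_injOn
          (fun pq => ((((ofLex pq.1).1 : ℕ), ((ofLex pq.2).1 : ℕ)), ((ofLex pq.1).2, (ofLex pq.2).2)))
          ?_ ?_
        · intro pq hpq
          rw [Finset.mem_coe, Finset.mem_filter, diag_adj_rectCastAdd_iff,
            fermionRectTorusDiagGraph_adj_iff] at hpq
          obtain ⟨-, hpq⟩ := hpq
          rw [Finset.coe_product, Set.mem_prod, Finset.coe_insert, Finset.coe_singleton,
            Set.mem_insert_iff, Set.mem_singleton_iff, Finset.coe_filter]
          by_cases h2 : ringAdj b ((ofLex pq.1).2 : ℕ) (ofLex pq.2).2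
          · refine ⟨?_, ⟨Finset.mem_univ _, h2⟩⟩
            have h' : ¬ (ringAdj (a₁ + a₂) ((ofLex pq.1).1 : ℕ) (ofLex pq.2).1 ↔
                ringAdj a₁ ((ofLex pq.1).1 : ℕ) (ofLex pq.2).1) := by
              intro hiff; apply hpq
              exact ⟨fun h => ⟨hiff.1 h.1, h.2⟩, fun h => ⟨hiff.2 h.1, h.2⟩⟩
            have hw := cut_low_wrap (L₂ := a₂) (ofLex pq.1).1.isLt (ofLex pq.2).1.isLt h'
            rcases hw with ⟨h1, h3⟩ | ⟨h1, h3⟩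
            · exact Or.inl (Prod.ext h1 h3)
            · exact Or.inr (Prod.ext h1 h3)
          · exfalso; apply hpq
            exact ⟨fun h => absurd h.2 h2, fun h => absurd h.2 h2⟩
        · intro pq _ pq' _ h
          simp only [Prod.mk.injEq] at h
          obtain ⟨⟨h1, h2⟩, h3, h4⟩ := h
          exact Prod.ext (ofLex.injective (Prod.ext (Fin.ext h1) h3))
            (ofLex.injective (Prod.ext (Fin.ext h2) h4))
    _ ≤ 2 * (2 * b) := by
        rw [Finset.card_product]
        exact Nat.mul_le_mul Finset.card_le_two (card_filter_ringAdj_le b)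
    _ = 4 * b := by ring

/-- **The diagonal seam, upper block**: at most `4b` discrepant ordered pairs; the counting step of
Ruelle's box cut for the diagonal bonds. [cite: Ruelle1969, §2.2] -/
theorem card_discrepancy_diag_rectNatAdd (a₁ a₂ b : ℕ) :
    #{pq : (Fin a₂ ×ₗ Fin b) × (Fin a₂ ×ₗ Fin b) |
        ¬ ((fermionRectTorusDiagGraph (a₁ + a₂) b).Adj (rectNatAdd a₁ a₂ b pq.1)
            (rectNatAdd a₁ a₂ b pq.2) ↔ (fermionRectTorusDiagGraph a₂ b).Adj pq.1 pq.2)} ≤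
      4 * b := by
  calc _ ≤ #(({((0 : ℕ), a₂ - 1), (a₂ - 1, 0)} : Finset (ℕ × ℕ)) ×ˢ
          ({uv : Fin b × Fin b | ringAdj b uv.1 uv.2} : Finset (Fin b × Fin b))) := by
        refine Finset.card_le_card_of_injOn
          (fun pq => ((((ofLex pq.1).1 : ℕ), ((ofLex pq.2).1 : ℕ)), ((ofLex pq.1).2, (ofLex pq.2).2)))
          ?_ ?_
        · intro pq hpq
          rw [Finset.mem_coe, Finset.mem_filter, diag_adj_rectNatAdd_iff,
            fermionRectTorusDiagGraph_adj_iff] at hpq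
          obtain ⟨-, hpq⟩ := hpq
          rw [Finset.coe_product, Set.mem_prod, Finset.coe_insert, Finset.coe_singleton,
            Set.mem_insert_iff, Set.mem_singleton_iff, Finset.coe_filter]
          by_cases h2 : ringAdj b ((ofLex pq.1).2 : ℕ) (ofLex pq.2).2
          · refine ⟨?_, ⟨Finset.mem_univ _, h2⟩⟩
            have h' : ¬ (ringAdj (a₁ + a₂) (a₁ + ((ofLex pq.1).1 : ℕ)) (a₁ + ((ofLex pq.2).1 : ℕ)) ↔
                ringAdj a₂ ((ofLex pq.1).1 : ℕ) (ofLex pq.2).1) := by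
              intro hiff; apply hpq
              exact ⟨fun h => ⟨hiff.1 h.1, h.2⟩, fun h => ⟨hiff.2 h.1, h.2⟩⟩
            have hw := cut_high_wrap (L₁ := a₁) (ofLex pq.1).1.isLt (ofLex pq.2).1.isLt h'
            rcases hw with ⟨h1, h3⟩ | ⟨h1, h3⟩
            · exact Or.inl (Prod.ext h1 h3)
            · exact Or.inr (Prod.ext h1 h3)
          · exfalso; apply hpq
            exact ⟨fun h => absurd h.2 h2, fun h => absurd h.2 h2⟩
        · intro pq _ pq' _ h
          simp only [Prod.mk.injEq] at h
          obtain ⟨⟨h1, h2⟩, h3, h4⟩ := h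
          exact Prod.ext (ofLex.injective (Prod.ext (Fin.ext h1) h3))
            (ofLex.injective (Prod.ext (Fin.ext h2) h4))
    _ ≤ 2 * (2 * b) := by
        rw [Finset.card_product]
        exact Nat.mul_le_mul Finset.card_le_two (card_filter_ringAdj_le b)
    _ = 4 * b := by ring

/-- **The major cut of the `t–t'` torus.** Cutting `ℤ/(a₁+a₂)ℤ × ℤ/bℤ` into `ℤ/a₁ℤ × ℤ/bℤ` and
`ℤ/a₂ℤ × ℤ/bℤ` costs at most `8|t| b + 16|t'| b`:
`E_{(a₁+a₂)×b}(N₁ + N₂) ≤ E_{a₁×b}(N₁) + E_{a₂×b}(N₂) + 8|t| b + 16|t'| b` for `N_i ≤ 2 a_i b`, `E`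
the sector ground-state energies of `hubbardRectTorusTT'` (n.n. seam `≤ 2b + 2b` ordered pairs at
`2|t|` each, diagonal seam `≤ 4b + 4b` at `2|t'|` each). Ruelle (1969) §2.2, for the `t–t'` model
of LeBlanc et al. (2015) eq. (1). [cite: Ruelle1969, §3.3] -/
theorem groundEnergy_hubbardRectTorusTT'_cut (a₁ a₂ b : ℕ) (t t' U : ℝ) {N₁ N₂ : ℕ}
    (hN₁ : N₁ ≤ 2 * (a₁ * b)) (hN₂ : N₂ ≤ 2 * (a₂ * b)) :
    groundEnergy (hubbardRectTorusTT' (a₁ + a₂) b t t' U) (N₁ + N₂) ≤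
      groundEnergy (hubbardRectTorusTT' a₁ b t t' U) N₁ +
        groundEnergy (hubbardRectTorusTT' a₂ b t t' U) N₂ + 8 * |t| * b + 16 * |t'| * b := by
  have h := groundEnergy_twoGraph_le_add_of_cut (fermionRectTorusGraph a₁ b)
    (fermionRectTorusDiagGraph a₁ b) (fermionRectTorusGraph a₂ b) (fermionRectTorusDiagGraph a₂ b)
    (fermionRectTorusGraph (a₁ + a₂) b) (fermionRectTorusDiagGraph (a₁ + a₂) b)
    (strictMono_rectCastAdd a₁ a₂ b) (strictMono_rectNatAdd a₁ a₂ b)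
    (rectCastAdd_lt_rectNatAdd a₁ a₂ b) (rectCastAdd_cover a₁ a₂ b)
    (card_discrepancy_rectCastAdd a₁ a₂ b) (card_discrepancy_rectNatAdd a₁ a₂ b)
    (card_discrepancy_diag_rectCastAdd a₁ a₂ b) (card_discrepancy_diag_rectNatAdd a₁ a₂ b)
    t U t' 0 (N₁ := N₁) (N₂ := N₂) (by rwa [card_rectSites]) (by rwa [card_rectSites])
  have e1 : (2 : ℝ) * |t| * ((2 * b : ℕ) + (2 * b : ℕ)) = 8 * |t| * b := by push_cast; ring
  have e2 : (2 : ℝ) * |t'| * ((4 * b : ℕ) + (4 * b : ℕ)) = 16 * |t'| * b := by push_cast; ring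
  rw [e1, e2] at h
  exact h

end DiagSeam

/-! ### Relabelling invariance: the coordinate swap -/

/-- The coordinate swap is an isomorphism of the diagonal graphs
`ℤ/aℤ × ℤ/bℤ ≅ ℤ/bℤ × ℤ/aℤ`. [folklore] -/
private theorem fermionRectTorusDiagGraph_adj_rectSwap {a b : ℕ} (p q : Fin a ×ₗ Fin b) :
    (fermionRectTorusDiagGraph b a).Adj (rectSwap a b p) (rectSwap a b q) ↔
      (fermionRectTorusDiagGraph a b).Adj p q := by
  rw [fermionRectTorusDiagGraph_adj_iff, fermionRectTorusDiagGraph_adj_iff]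
  exact And.comm

/-- The coordinate swap relabels the `t–t'` Hamiltonian of `ℤ/aℤ × ℤ/bℤ` into that of
`ℤ/bℤ × ℤ/aℤ`. [folklore] -/
private theorem relabel_hubbardRectTorusTT'_swap (a b : ℕ) (t t' U : ℝ) :
    relabel (Orb.mapEquiv (rectSwap a b)) (hubbardRectTorusTT' a b t t' U) =
      hubbardRectTorusTT' b a t t' U := by
  unfold hubbardRectTorusTT'
  rw [map_add, relabel_hamiltonian _ _ (rectSwap a b) fermionRectTorusGraph_adj_rectSwap t U,
    relabel_hamiltonian _ _ (rectSwap a b) fermionRectTorusDiagGraph_adj_rectSwap t' 0]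

/-- **Swap invariance of the `t–t'` sector energies**: `E_{a×b}(N) = E_{b×a}(N)` — the coordinate
swap is a one-particle bijection, implemented on Fock space by a signed permutation of the
occupation basis which conjugates `hubbardRectTorusTT' a b` into `hubbardRectTorusTT' b a`
(Bratteli–Robinson II §5.2.2, quasi-free / Bogoliubov automorphisms induced by one-particle
unitaries; tree `groundEnergy_relabel`). [cite: BratteliRobinsonII1997, §5.2.2] -/
theorem groundEnergy_hubbardRectTorusTT'_swap (a b : ℕ) (t t' U : ℝ) (N : ℕ) :
    groundEnergy (hubbardRectTorusTT' b a t t' U) N = groundEnergy (hubbardRectTorusTT' a b t t' U) N := by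
  rw [← relabel_hubbardRectTorusTT'_swap a b t t' U, groundEnergy_relabel]

end Literature.MathematicalPhysics.QuantumLattice

end
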